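import Literature.NumberTheory.EllipticCurves.BSDHeegnerPointsGrossZagierProofs
import Literature.NumberTheory.EllipticCurves.BSDHeegnerPointsSignEvenProofs
import HarnessLib

/-!
# `ord_{s=1} L(E/K, s) = 1 ↔ L'(E/K, 1) ≠ 0` from the Modularity Theorem alone

Sibling proof file of `Literature/NumberTheory/EllipticCurves/BSDHeegnerPoints.lean` for the named
fact `Literature.NumberTheory.EllipticCurves.analyticRankEK_eq_one_iff_LDerivEK_ne_zero W N K`
(Gross–Zagier 1986, I.§7): for `E/ℚ` elliptic of conductor `N` and `K` imaginary quadratic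
satisfying the Heegner hypothesis for `N`, `ord_{s=1} L(E/K, s) = 1 ↔ L'(E/K, 1) ≠ 0`.

The printed argument has two inputs:

1. (complex analysis, folklore) at a *genuine* zero `z₀` of an analytic germ `f` (order `≥ 1`),
   the order is `1` iff `f'(z₀) ≠ 0` — `analyticOrderNatAt_eq_one_iff_deriv_ne_zero` and the
   threaded `analyticRankEK_eq_one_iff_LDerivEK_ne_zero_of (h : one_le_analyticRankEK W N K)`
   (`BSDHeegnerPointsGrossZagierProofs`); the forward direction is unconditional
   (`LDerivEK_ne_zero_of_analyticRankEK_eq_one`, `LeadingTermProofs`), the converse is false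
   without `L(E/K, 1) = 0` (shape `f(1) ≠ 0`, `f'(1) ≠ 0` has order `0`);
2. (arithmetic) `L(E/K, 1) = L(E, 1) L(E^{(d_K)}, 1) = 0`, i.e. `1 ≤ ord_{s=1} L(E/K, s)` — the
   sign `−1` of the functional equation of `L(E/K, s)` under the Heegner hypothesis (Gross 1984,
   §5; Gross–Zagier 1986, IV (0.1)–(0.2)); in the tree this is the named fact
   `one_le_analyticRankEK W N K`, which `BSDHeegnerPointsSign{,Twist,Odd,Even}Proofs` derive from
   the single named fact `Literature.NumberTheory.EllipticCurves.ModularForms.exists_isNewformOf`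
   (the Modularity Theorem: Breuil–Conrad–Diamond–Taylor 2001, Thm. A, level `N_E` by Carayol) as
   `one_le_analyticRankEK_of_exists_isNewformOf`.

Composing the two:

* `analyticRankEK_eq_one_iff_LDerivEK_ne_zero_of_exists_isNewformOf` — **the named fact
  `analyticRankEK_eq_one_iff_LDerivEK_ne_zero W N K` follows, for every `W`, `N`, `K`, from
  `exists_isNewformOf` and nothing else**; the discharge
  `analyticRankEK_eq_one_iff_LDerivEK_ne_zero_holds` is therefore exactly
  `analyticRankEK_eq_one_iff_LDerivEK_ne_zero_of_exists_isNewformOf W N K exists_isNewformOf_holds`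
  once the modularity fact is discharged (no unconditional proof is possible before that: without
  an entire continuation `WeierstrassCurve.entireLFunction` is the raw Dirichlet series, whose
  behaviour at `s = 1` is not decided by anything in the tree, and with it the converse direction
  *is* the vanishing `L(E/K, 1) = 0`);
* `analyticRankEK_eq_one_iff_heegner_nonTorsion_of_exists_isNewformOf` — likewise bsd.S16's
  corollary `ord_{s=1} L(E/K, s) = 1 ↔ P_K` non-torsion
  (`analyticRankEK_eq_one_iff_heegner_nonTorsion W N K`) needs exactly the Gross–Zagier formula
  (`gross_zagier N W K`, Gross–Zagier 1986, Thm. I.(6.3)) and `exists_isNewformOf`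
  (`analyticRankEK_eq_one_iff_heegner_nonTorsion_of_one_le`, `BSDHeegnerPointsGrossZagierProofs`).

Everything is proved; no named facts are introduced (D-0026).

## References

* [GrossZagier1986] B. H. Gross, D. B. Zagier, *Heegner points and derivatives of `L`-series*,
  Invent. Math. 84 (1986), 225–320, I.§7, Thm. I.(6.3), IV (0.1)–(0.2).
* [Gross1984] B. H. Gross, *Heegner points on `X₀(N)`*, in *Modular Forms* (R. A. Rankin, ed.),
  Ellis Horwood (1984), 87–105, §5.
* [BCDTJAMS2001] C. Breuil, B. Conrad, F. Diamond, R. Taylor, *On the modularity of elliptic curves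
  over `ℚ`: wild 3-adic exercises*, J. Amer. Math. Soc. 14 (2001), 843–939, Thm. A.
-/

noncomputable section

open scoped Classical

open Literature.NumberTheory.EllipticCurves.ModularForms

universe u

namespace Literature.NumberTheory.EllipticCurves

variable (W : WeierstrassCurve ℚ) (N : ℕ) (K : Type u) [Field K] [NumberField K]

/-- **`ord_{s=1} L(E/K, s) = 1 ↔ L'(E/K, 1) ≠ 0` from the Modularity Theorem alone**
(Gross–Zagier 1986, I.§7). Assume `exists_isNewformOf` — every elliptic curve over `ℚ` has a
newform `f ∈ S₂(Γ₀(N_E))` with `aₙ(f) = aₙ(E)` (Breuil–Conrad–Diamond–Taylor 2001, Thm. A). Then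
for `W/ℚ` elliptic of conductor `N` and `K` imaginary quadratic satisfying the Heegner hypothesis
for `N`, `ord_{s=1} L(E, s) L(E^{(d_K)}, s) = 1 ↔ (L(E, s) L(E^{(d_K)}, s))'(1) ≠ 0`: the order is
`≥ 1` by `one_le_analyticRankEK_of_exists_isNewformOf` (sign `−1`, Gross 1984, §5), and a genuine
zero is simple iff the first derivative is non-zero
(`analyticRankEK_eq_one_iff_LDerivEK_ne_zero_of`). [cite: GrossZagier1986, I.§7] -/
theorem analyticRankEK_eq_one_iff_LDerivEK_ne_zero_of_exists_isNewformOf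
    (hmod : exists_isNewformOf) : analyticRankEK_eq_one_iff_LDerivEK_ne_zero W N K :=
  analyticRankEK_eq_one_iff_LDerivEK_ne_zero_of W N K
    (one_le_analyticRankEK_of_exists_isNewformOf W N K hmod)

/-- **bsd.S16's corollary from Gross–Zagier and the Modularity Theorem** (Gross–Zagier 1986,
Thm. I.(6.3) with V.§2; Gross 1991, (1.1)). Assume the Gross–Zagier formula `gross_zagier N W K`
and `exists_isNewformOf`. Then for an elliptic curve with globally minimal model `W` of conductor
`N`, an imaginary quadratic `K` satisfying the Heegner hypothesis for `N` and a Heegner point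
`P ∈ E(K)` of level `N`: `ord_{s=1} L(E/K, s) = 1 ↔ P` has infinite order
(`analyticRankEK_eq_one_iff_heegner_nonTorsion_of_one_le` fed with
`one_le_analyticRankEK_of_exists_isNewformOf`). [cite: GrossZagier1986, Thm. I.(6.3) with V.§2] -/
theorem analyticRankEK_eq_one_iff_heegner_nonTorsion_of_exists_isNewformOf [NeZero N]
    (hGZ : gross_zagier N W K) (hmod : exists_isNewformOf) :
    analyticRankEK_eq_one_iff_heegner_nonTorsion W N K :=
  analyticRankEK_eq_one_iff_heegner_nonTorsion_of_one_le W N K hGZ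
    (one_le_analyticRankEK_of_exists_isNewformOf W N K hmod)

end Literature.NumberTheory.EllipticCurves

end
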